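import Summits.QuantumFields.BalabanUV.T4Continuum.Spine.NE7.Targets

/-!
# BalabanUVNodes ∕ node N19 (NE7) — THE RE-KEYING CALCULUS of node U5's hybrid binder list: how `Spine.NE7.Core`,
# `T4WeightBudget.RelWeightBound` (NE7b), `T4IndicatorShell.ShellWeightBound` (NE7c) and `T4MatchingAssembly.HybridNE7` move along
# a CLASS MAP of BOTH runs (node U5d's partial summation `classVal` ∕ `fiberSum`, two-sided), and the BAD ⇒ SHELL fold

Cell `pub-ymgap` (HUMAN RULING D-0062 Track A ∕ D-0149 width seats), WIDTH SEAT `pub-ymgap-dag-n19-w1` (node n19 = NE7, seat 1 of 3), generation g2,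
INTENT-1 (bus CLAIM 2026-08-28T01:02Z).  Route `Summits/QuantumFields/YangMills/Theses/BalabanUVNodes.lean`, key item K3⁷ `SpineGivenEndpointR13SepCoPH`
(stmt-QuantumFields-20544); filed `--kind proof --supports … --as helper`.  COUNT-NEUTRAL.  THEOREMS ONLY (0 `def`, 0 `sorry`).  ADDITIVE — imports the tree's
`Spine/NE7/Targets` only (through it `T4MatchingAssembly` (`HybridNE7`, `classVal`, `sum_classVal`, `classVal_nonneg`, `sum_classVal_eq_filter`), `T4WeightBudget`
(`RelWeightBound`), `T4IndicatorShell` (`ShellWeightBound`), `T4HybridMatching` (`fiberSum`, `hybridDelta`)) — all CITED BY NAME; modifies nothing.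

WHY.  Every face of node U5's hybrid binder list is typed at ONE class key (`T4MatchingAssembly.HybridNE7`: index family `T K`, terms `A`, `B`, bad class `Bad K t`,
shells `shA`, `shB`, weights `W`, `Wsh`, rate `δ`; at the ₁₃ record dag-n20-d's reading `crOfRecord₁₃VAt` on the σ-packed key `Σ K, SiteSeqKey F (K₀ + K)`, whose N19′
slot is leaf D's `hedge ∕ h19 : ∃ δ, Core … δ ∧ Summable δ`).  A RE-KEYING — classing the same terms by a COARSER key along a class map `π K : σ → ι` (a prefix of the
history, the large-field part only, a block-down, …) — replaces every family by its fibre sums `classVal S π a K t τ = Σ_{s ∈ S K, π K s = τ} a K t s` (node U5d's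
partial summation; `T4MatchingAssembly` §3 is the ONE-SIDED case, run A fixed on `ι`).  This file records, binder by binder, what survives a re-keying of BOTH runs and at
what price, so that any consumer wanting N19's ∕ N20's ∕ N21's faces at a COARSER CLASS KEY than the reading's gets them by ONE application:
* §1 [folklore] algebra of `classVal`: `classVal_apply` · `classVal_sub` ∕ `classVal_sub_fun` (cores re-key to cores) · `classVal_mono` · `classVal_comp` (functoriality:
  re-keying twice = re-keying by the composite) · `classVal_collapse` (the collapse `σ → Unit` re-keys a family to its TOTAL) · `sum_classVal_image`.
* §2 [folklore] ★★ `core_classVal` — `Core` DESCENDS along every class map under the sole condition «fine bad ⇒ coarse bad», with the SAME `c_K` and the SAME `δ`: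
  sandwiches with ONE class-uniform constant ADD UP over a fibre (exactly where `HybridNE7.core`'s class-uniformity is consumed); `coreEdge_classVal` (the `∃ δ, Core ∧
  Summable δ` shape descends); ★ `core_image` ∕ `coreEdge_image` (class set and bad class := the IMAGES: no side condition at all).
* §3 [folklore] ★ `relWeightBound_classVal` (NE7b DESCENDS when the coarse bad class pulls back into the fine one) · `relWeightBound_of_classVal` (ASCENDS under the
  cover; the tree's `T4AgeZeroLayer.relWeightBound_layer` is the product-refinement instance) · ★ `relWeightBound_classVal_iff` (SATURATED class maps — no fibre
  mixes bad with good —: NE7b's face is KEY-RESOLUTION-FREE).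
* §4 [folklore] `shellWeightBound_classVal` (NE7c ALWAYS descends; shells re-keyed to their fibre sums).
* §5 [folklore] `sum_ite_bad_le` · `shellWeightBound_foldBad` · `core_foldBad` · ★★ `hybridNE7_foldBad` (SAME KEY: the
  bad-CLASS slot FOLDS into the SHELL slot — `HybridNE7 … Bad W shA shB Wsh δ → HybridNE7 … ∅ 0 shA♯ shB♯ (W + Wsh) δ`, `sh♯ :=` the whole term on `Bad`, the old
  shell off it; converse «shell ⇒ bad class» = the tree's `T4IndicatorShell.relWeightBound_ref` on the refined key `ι ⊕ ι`) · `hybridDelta_foldBad` (OUTPUT-LOSSLESS: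
  node U5's exit reads the weights only through `hybridDelta vol δ (W + Wsh)`) · ★★ `hybridNE7_classVal` (SATURATED DESCENT of the whole binder list: same `W`, `Wsh`, `δ`) ·
  ★ `hybridNE7_classVal_foldBad` (UNSATURATED class maps: fold, then descend — no side condition) · `hybridNE7_image` · `hybridNE7_image_foldBad`.
* NON-ASCENT (reading; kernel dictionary `classVal_collapse`): `Core` does NOT ascend to a finer key — this seat's g0 `…N19DefectGasManyClasses.exists_totalCore_not_core`
  (p587708 §4) is the collapse `Bool → Unit`: `Core` of the totals with `δ = 0`, yet NO summable `δ` gives `Core` on the two fine classes.  The key resolution AT WHICH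
  `Core` IS PRODUCED is the whole of N19's content; every re-keying afterwards is free (§2) and may only coarsen.
READINGS.  (i) N19's slot transfers to every COARSER reading (bad := image) with the same `δ`, for free (`coreEdge_image`); (ii) N20's `RelWeightBound` iff the coarsening
never merges bad with good, else fold (free at node U5's exit); (iii) N21's always; (iv) nothing ascends except `RelWeightBound` under saturation — a re-classing
of the spine reading may only COARSEN the class key of `crOfRecord₁₃VAt`, never refine it without new content.  (This concerns the CLASS key `ι`; the K3⁷ v3
«tuned-prefix» question — slots under `ForSmallCouplings` in `g₀` — is orthogonal and untouched here.)

HONEST FRAMING.  Finite-sum bookkeeping [folklore] over the tree's SHAPES; nothing of Bałaban's asserted or instantiated; no estimate of the programme is proved.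
NE7 ∕ NE7b ∕ NE7c NOT PRINTED as two-run statements for d = 4 (NODE O's objects) ∕ NOT proved; N19 NOT discharged (0∕1); K3⁷ NOT claimed; counts UNMOVED (typed
28∕28 · discharged 5∕27).  Everything PROVED (0 `sorry`, 0 named facts, standard axioms).  One finite four-torus programme at fixed ε — NOT ℝ⁴, NOT infinite volume,
NOT OS, NOT a mass gap, NOT the Clay problem (R4 closes the conditional finite-𝕋⁴ rung `BalabanLadder.UV` only).
-/

noncomputable section

namespace Summit.QuantumFields.YangMills.BalabanUVNodes.N19RekeyingCalculus

open Finset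
open Summit.QuantumFields.BalabanUV.T4Continuum.Spine.NE7 (Core)
open Literature.MathematicalPhysics.QuantumFieldTheory.Balaban1983to89
open T4WeightBudget (RelWeightBound)
open T4IndicatorShell (ShellWeightBound)
open T4MatchingAssembly (HybridNE7 classVal sum_classVal classVal_nonneg sum_classVal_eq_filter)
open T4HybridMatching (fiberSum hybridDelta)

variable {σ ι : Type*} [DecidableEq ι]

/-! ## §1 Algebra of the re-keyed families `classVal S π a` -/

section Algebra
variable {S : ℕ → Finset σ} {T : ℕ → Finset ι} {π : ℕ → σ → ι} {a sha : ℕ → ℝ → σ → ℝ}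

/-- The re-keyed family, unfolded: `classVal S π a K t τ = Σ_{s ∈ S K, π K s = τ} a K t s` (node U5d's fibre sum, `T4HybridMatching.fiberSum`). [folklore] -/
theorem classVal_apply (S : ℕ → Finset σ) (π : ℕ → σ → ι) (a : ℕ → ℝ → σ → ℝ) (K : ℕ) (t : ℝ) (τ : ι) :
    classVal S π a K t τ = ∑ s ∈ (S K).filter (fun s => π K s = τ), a K t s :=
  rfl

/-- **CORES RE-KEY TO CORES**: the fibre sum of a difference `a − sha` is the difference of the fibre sums. [folklore] -/
theorem classVal_sub (S : ℕ → Finset σ) (π : ℕ → σ → ι) (a sha : ℕ → ℝ → σ → ℝ) (K : ℕ) (t : ℝ) (τ : ι) :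
    classVal S π (fun K t s => a K t s - sha K t s) K t τ = classVal S π a K t τ - classVal S π sha K t τ := by
  simp only [classVal_apply, Finset.sum_sub_distrib]

/-- `classVal_sub` as an equality of families (the form `HybridNE7.core` consumes). [folklore] -/
theorem classVal_sub_fun (S : ℕ → Finset σ) (π : ℕ → σ → ι) (a sha : ℕ → ℝ → σ → ℝ) :
    (classVal S π fun K t s => a K t s - sha K t s) = fun K t τ => classVal S π a K t τ - classVal S π sha K t τ :=
  funext fun K => funext fun t => funext fun τ => classVal_sub S π a sha K t τ

/-- Fibre sums are monotone in the family (termwise on `S K`). [folklore] -/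
theorem classVal_mono {K : ℕ} {t : ℝ} (h : ∀ s ∈ S K, sha K t s ≤ a K t s) (τ : ι) :
    classVal S π sha K t τ ≤ classVal S π a K t τ :=
  Finset.sum_le_sum fun s hs => h s (Finset.mem_filter.mp hs).1

/-- **FUNCTORIALITY**: re-keying along `π` and then along `ρ` is re-keying along the composite `ρ ∘ π` (when `π K` maps `S K` into `T K`). [folklore] -/
theorem classVal_comp {υ : Type*} [DecidableEq υ] (ρ : ℕ → ι → υ) (hmaps : ∀ K, ∀ s ∈ S K, π K s ∈ T K) (K : ℕ) (t : ℝ) (u : υ) :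
    classVal T ρ (classVal S π a) K t u = classVal S (fun K s => ρ K (π K s)) a K t u := by
  simp only [classVal_apply]
  rw [← Finset.sum_fiberwise_of_maps_to (s := (S K).filter fun s => ρ K (π K s) = u) (t := (T K).filter fun τ => ρ K τ = u)
    (g := π K) (fun s hs => Finset.mem_filter.mpr ⟨hmaps K s (Finset.mem_filter.mp hs).1, (Finset.mem_filter.mp hs).2⟩) (a K t)]
  refine Finset.sum_congr rfl fun τ hτ => Finset.sum_congr ?_ fun _ _ => rfl
  ext s
  simp only [Finset.mem_filter]
  constructor
  · rintro ⟨hs, hπ⟩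
    exact ⟨⟨hs, by rw [hπ]; exact (Finset.mem_filter.mp hτ).2⟩, hπ⟩
  · rintro ⟨⟨hs, _⟩, hπ⟩
    exact ⟨hs, hπ⟩

omit [DecidableEq ι] in
/-- **THE COLLAPSE** `σ → Unit` re-keys a family to its TOTAL: `classVal S (fun _ _ => ()) a K t () = Σ_{s ∈ S K} a K t s` — so a one-class `Core` of the totals
(this seat's g0 `…N19KingLocalTwoClass.core_goodSum_of_core_total`, `…N19DefectGasManyClasses.exists_totalCore_not_core`) IS `Core` at the coarsest key. [folklore] -/
theorem classVal_collapse (S : ℕ → Finset σ) (a : ℕ → ℝ → σ → ℝ) (K : ℕ) (t : ℝ) :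
    classVal S (fun _ _ => ()) a K t () = ∑ s ∈ S K, a K t s := by
  rw [classVal_apply, Finset.filter_true_of_mem fun _ _ => rfl]

/-- Re-keying along `π` onto the IMAGE key preserves every total (the E1∕E2 dictionary `Z K t = Σ_T A K t` moves with the key). [folklore] -/
theorem sum_classVal_image (S : ℕ → Finset σ) (π : ℕ → σ → ι) (a : ℕ → ℝ → σ → ℝ) (K : ℕ) (t : ℝ) :
    ∑ τ ∈ (S K).image (π K), classVal S π a K t τ = ∑ s ∈ S K, a K t s :=
  sum_classVal (T := fun K => (S K).image (π K)) (fun _ hs => Finset.mem_image_of_mem (π K) hs) t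

end Algebra

/-! ## §2 `Core` DESCENDS along every class map (same constant, same rate) -/

section CoreDescent
variable [DecidableEq σ] {l₀ vol : ℝ} {S : ℕ → Finset σ} {T : ℕ → Finset ι} {π : ℕ → σ → ι} {p q : ℕ → ℝ → σ → ℝ}
  {SBad : ℕ → ℝ → Finset σ} {Bad : ℕ → ℝ → Finset ι} {δ : ℕ → ℝ}

/-- **★★ `Core` DESCENDS ALONG A CLASS MAP** [folklore].  If the fine cores `p` (run A), `q` (run B) on the key `σ` satisfy `Core l₀ vol S SBad p q δ` and the coarse bad class COVERS
the fine one («`s ∈ SBad K t ⇒ π K s ∈ Bad K t`»: no fine-bad term hides in a coarse-good class), then the re-keyed cores satisfy `Core l₀ vol T Bad (classVal S π p) (classVal S π q) δ`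
with the SAME constant `c_K` and the SAME rate `δ`: over a coarse-good fibre every term is fine-good, and two-sided sandwiches `e^{c − vol·δ_K}·p ≤ q ≤ e^{c + vol·δ_K}·p` with ONE
class-uniform constant ADD UP.  (This is the step that consumes the class-uniformity of `c_K`, the load-bearing clause of `HybridNE7.core`; with class-dependent constants the
coarse sandwich would inflate by their spread.)  No positivity, no `hmaps`, no `Bad ⊆ T` needed. -/
theorem core_classVal (h : Core l₀ vol S SBad p q δ)
    (hcover : ∀ (K : ℕ) (t : ℝ), |t| ≤ l₀ → ∀ s ∈ S K, s ∈ SBad K t → π K s ∈ Bad K t) :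
    Core l₀ vol T Bad (classVal S π p) (classVal S π q) δ := by
  intro K
  obtain ⟨c, hc⟩ := h K
  refine ⟨c, fun t ht τ hτ => ?_⟩
  have hτ' : τ ∉ Bad K t := (Finset.mem_sdiff.mp hτ).2
  have key : ∀ s ∈ (S K).filter (fun s => π K s = τ),
      Real.exp (c - vol * δ K) * p K t s ≤ q K t s ∧ q K t s ≤ Real.exp (c + vol * δ K) * p K t s := by
    intro s hs
    obtain ⟨hsS, hπ⟩ := Finset.mem_filter.mp hs
    exact hc t ht s (Finset.mem_sdiff.mpr ⟨hsS, fun hbad => hτ' (hπ ▸ hcover K t ht s hsS hbad)⟩)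
  simp only [classVal_apply, Finset.mul_sum]
  exact ⟨Finset.sum_le_sum fun s hs => (key s hs).1, Finset.sum_le_sum fun s hs => (key s hs).2⟩

/-- **LEAF D's `hedge ∕ h19` SHAPE DESCENDS**: `∃ δ, Core ∧ Summable δ` at the fine key gives the same at every covered coarse key, with the same `δ`. [folklore] -/
theorem coreEdge_classVal (h : ∃ δ : ℕ → ℝ, Core l₀ vol S SBad p q δ ∧ Summable δ)
    (hcover : ∀ (K : ℕ) (t : ℝ), |t| ≤ l₀ → ∀ s ∈ S K, s ∈ SBad K t → π K s ∈ Bad K t) :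
    ∃ δ : ℕ → ℝ, Core l₀ vol T Bad (classVal S π p) (classVal S π q) δ ∧ Summable δ := by
  obtain ⟨δ, hC, hs⟩ := h
  exact ⟨δ, core_classVal hC hcover, hs⟩

/-- **★ `Core` AT THE IMAGE KEY — NO SIDE CONDITION**: class set `:= (S K).image (π K)`, bad class `:= (SBad K t).image (π K)`. [folklore] -/
theorem core_image (h : Core l₀ vol S SBad p q δ) :
    Core l₀ vol (fun K => (S K).image (π K)) (fun K t => (SBad K t).image (π K)) (classVal S π p) (classVal S π q) δ :=
  core_classVal h fun K _ _ _ _ hs => Finset.mem_image_of_mem (π K) hs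

/-- `coreEdge_classVal` at the image key — no side condition. [folklore] -/
theorem coreEdge_image (h : ∃ δ : ℕ → ℝ, Core l₀ vol S SBad p q δ ∧ Summable δ) :
    ∃ δ : ℕ → ℝ, Core l₀ vol (fun K => (S K).image (π K)) (fun K t => (SBad K t).image (π K)) (classVal S π p) (classVal S π q) δ ∧ Summable δ :=
  coreEdge_classVal h fun K _ _ _ _ hs => Finset.mem_image_of_mem (π K) hs

end CoreDescent

/-! ## §3 `RelWeightBound` (NE7b): descent under pull-back, ascent under cover, invariance under saturation -/

section Weight
variable {l₀ : ℝ} {S : ℕ → Finset σ} {T : ℕ → Finset ι} {π : ℕ → σ → ι} {a b : ℕ → ℝ → σ → ℝ}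
  {SBad : ℕ → ℝ → Finset σ} {Bad : ℕ → ℝ → Finset ι} {W : ℕ → ℝ}

/-- A sum of non-negative terms over the PULL-BACK of the coarse bad class is at most the sum over the fine bad class containing it. [folklore] -/
theorem sum_filter_mem_le_sum_bad {K : ℕ} {t : ℝ} {f : σ → ℝ} (hSBad : SBad K t ⊆ S K)
    (hpull : ∀ s ∈ S K, π K s ∈ Bad K t → s ∈ SBad K t) (hf : ∀ s ∈ S K, 0 ≤ f s) :
    ∑ s ∈ (S K).filter (fun s => π K s ∈ Bad K t), f s ≤ ∑ s ∈ SBad K t, f s :=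
  Finset.sum_le_sum_of_subset_of_nonneg
    (fun s hs => hpull s (Finset.mem_filter.mp hs).1 (Finset.mem_filter.mp hs).2) fun s hs _ => hf s (hSBad hs)

/-- … and conversely a sum over the fine bad class is at most the sum over the pull-back of a coarse bad class COVERING it. [folklore] -/
theorem sum_bad_le_sum_filter_mem {K : ℕ} {t : ℝ} {f : σ → ℝ} (hSBad : SBad K t ⊆ S K)
    (hcover : ∀ s ∈ S K, s ∈ SBad K t → π K s ∈ Bad K t) (hf : ∀ s ∈ S K, 0 ≤ f s) :
    ∑ s ∈ SBad K t, f s ≤ ∑ s ∈ (S K).filter (fun s => π K s ∈ Bad K t), f s :=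
  Finset.sum_le_sum_of_subset_of_nonneg (fun s hs => Finset.mem_filter.mpr ⟨hSBad hs, hcover s (hSBad hs) hs⟩)
    fun s hs _ => hf s (Finset.mem_filter.mp hs).1

/-- **★ NE7b DESCENDS** [folklore]: `RelWeightBound l₀ S a b SBad W` for non-negative fine terms, a class map into `T`, a coarse bad class `Bad ⊆ T` whose PULL-BACK lies in the fine
bad class («`π K s ∈ Bad K t ⇒ s ∈ SBad K t`»: the coarse bad class claims no fine-good mass) ⇒ `RelWeightBound l₀ T (classVal S π a) (classVal S π b) Bad W`, SAME `W`.
(`T4MatchingAssembly.relWeightBound_of_fibres` is the one-sided ancestor: run A given on `ι`.) -/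
theorem relWeightBound_classVal (h : RelWeightBound l₀ S a b SBad W)
    (hmaps : ∀ K, ∀ s ∈ S K, π K s ∈ T K) (hBad : ∀ (K : ℕ) (t : ℝ), |t| ≤ l₀ → Bad K t ⊆ T K)
    (hpull : ∀ (K : ℕ) (t : ℝ), |t| ≤ l₀ → ∀ s ∈ S K, π K s ∈ Bad K t → s ∈ SBad K t)
    (ha : ∀ (K : ℕ) (t : ℝ), |t| ≤ l₀ → ∀ s ∈ S K, 0 ≤ a K t s) (hb : ∀ (K : ℕ) (t : ℝ), |t| ≤ l₀ → ∀ s ∈ S K, 0 ≤ b K t s) :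
    RelWeightBound l₀ T (classVal S π a) (classVal S π b) Bad W where
  bad_subset := hBad
  nonneg := h.nonneg
  lt_one := h.lt_one
  summable := h.summable
  bad_left K t ht := by
    rw [sum_classVal_eq_filter, sum_classVal (hmaps K)]; exact (sum_filter_mem_le_sum_bad (h.bad_subset K t ht) (hpull K t ht) (ha K t ht)).trans (h.bad_left K t ht)
  bad_right K t ht := by
    rw [sum_classVal_eq_filter, sum_classVal (hmaps K)]; exact (sum_filter_mem_le_sum_bad (h.bad_subset K t ht) (hpull K t ht) (hb K t ht)).trans (h.bad_right K t ht)

/-- **NE7b ASCENDS UNDER THE COVER** [folklore]: a relative weight bound at the coarse key, for a coarse bad class COVERING the fine one, is a relative weight bound at the fine key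
with the SAME `W` (totals agree; the fine bad mass sits inside the pull-back).  The tree's `T4AgeZeroLayer.relWeightBound_layer` is the product-refinement instance. -/
theorem relWeightBound_of_classVal (h : RelWeightBound l₀ T (classVal S π a) (classVal S π b) Bad W)
    (hmaps : ∀ K, ∀ s ∈ S K, π K s ∈ T K) (hSBad : ∀ (K : ℕ) (t : ℝ), |t| ≤ l₀ → SBad K t ⊆ S K)
    (hcover : ∀ (K : ℕ) (t : ℝ), |t| ≤ l₀ → ∀ s ∈ S K, s ∈ SBad K t → π K s ∈ Bad K t)
    (ha : ∀ (K : ℕ) (t : ℝ), |t| ≤ l₀ → ∀ s ∈ S K, 0 ≤ a K t s) (hb : ∀ (K : ℕ) (t : ℝ), |t| ≤ l₀ → ∀ s ∈ S K, 0 ≤ b K t s) :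
    RelWeightBound l₀ S a b SBad W where
  bad_subset := hSBad
  nonneg := h.nonneg
  lt_one := h.lt_one
  summable := h.summable
  bad_left K t ht := by
    have h1 := h.bad_left K t ht; rw [sum_classVal_eq_filter, sum_classVal (hmaps K)] at h1
    exact (sum_bad_le_sum_filter_mem (hSBad K t ht) (hcover K t ht) (ha K t ht)).trans h1
  bad_right K t ht := by
    have h1 := h.bad_right K t ht; rw [sum_classVal_eq_filter, sum_classVal (hmaps K)] at h1
    exact (sum_bad_le_sum_filter_mem (hSBad K t ht) (hcover K t ht) (hb K t ht)).trans h1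

/-- **★ NE7b IS KEY-RESOLUTION-FREE ALONG SATURATED CLASS MAPS** [folklore]: when no fibre mixes bad with good («`s ∈ SBad K t ↔ π K s ∈ Bad K t` on `S K`»), the relative
weight bound holds at the fine key iff it holds at the coarse key, with the same `W`. -/
theorem relWeightBound_classVal_iff (hmaps : ∀ K, ∀ s ∈ S K, π K s ∈ T K)
    (hBad : ∀ (K : ℕ) (t : ℝ), |t| ≤ l₀ → Bad K t ⊆ T K) (hSBad : ∀ (K : ℕ) (t : ℝ), |t| ≤ l₀ → SBad K t ⊆ S K)
    (hsat : ∀ (K : ℕ) (t : ℝ), |t| ≤ l₀ → ∀ s ∈ S K, (s ∈ SBad K t ↔ π K s ∈ Bad K t))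
    (ha : ∀ (K : ℕ) (t : ℝ), |t| ≤ l₀ → ∀ s ∈ S K, 0 ≤ a K t s) (hb : ∀ (K : ℕ) (t : ℝ), |t| ≤ l₀ → ∀ s ∈ S K, 0 ≤ b K t s) :
    RelWeightBound l₀ S a b SBad W ↔ RelWeightBound l₀ T (classVal S π a) (classVal S π b) Bad W :=
  ⟨fun h => relWeightBound_classVal h hmaps hBad (fun K t ht s hs => (hsat K t ht s hs).2) ha hb,
    fun h => relWeightBound_of_classVal h hmaps hSBad (fun K t ht s hs => (hsat K t ht s hs).1) ha hb⟩

end Weight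

/-! ## §4 `ShellWeightBound` (NE7c): always descends -/

section Shell
variable {l₀ : ℝ} {S : ℕ → Finset σ} {T : ℕ → Finset ι} {π : ℕ → σ → ι} {a b sha shb : ℕ → ℝ → σ → ℝ} {Wsh : ℕ → ℝ}

/-- **NE7c DESCENDS ALONG EVERY CLASS MAP** [folklore]: shells re-keyed to their fibre sums keep `0 ≤ sh ≤ term` termwise and the same relative total weight `Wsh`
(`T4MatchingAssembly.shellWeightBound_of_fibres` is the one-sided ancestor). -/
theorem shellWeightBound_classVal (h : ShellWeightBound l₀ S a b sha shb Wsh) (hmaps : ∀ K, ∀ s ∈ S K, π K s ∈ T K) :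
    ShellWeightBound l₀ T (classVal S π a) (classVal S π b) (classVal S π sha) (classVal S π shb) Wsh where
  nonneg := h.nonneg
  summable := h.summable
  sh_nonneg_left K t ht τ _ := classVal_nonneg (h.sh_nonneg_left K t ht) τ
  sh_le_left K t ht τ _ := classVal_mono (h.sh_le_left K t ht) τ
  sh_nonneg_right K t ht τ _ := classVal_nonneg (h.sh_nonneg_right K t ht) τ
  sh_le_right K t ht τ _ := classVal_mono (h.sh_le_right K t ht) τ
  left K t ht := by rw [sum_classVal (hmaps K), sum_classVal (hmaps K)]; exact h.left K t ht
  right K t ht := by rw [sum_classVal (hmaps K), sum_classVal (hmaps K)]; exact h.right K t ht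

end Shell

/-! ## §5 `HybridNE7`: the BAD ⇒ SHELL fold, saturated descent, unsaturated descent -/

section Fold
variable {l₀ vol : ℝ}

/-- The fold's shell total: `Σ_T (term on Bad, shell off Bad) ≤ Σ_Bad term + Σ_T shell ≤ (w + wsh)·Σ_T term`. [folklore] -/
theorem sum_ite_bad_le {Tc Bd : Finset ι} {A sh : ι → ℝ} {w wsh : ℝ} (hBd : Bd ⊆ Tc) (hsh0 : ∀ τ ∈ Tc, 0 ≤ sh τ)
    (hbad : ∑ τ ∈ Bd, A τ ≤ w * ∑ τ ∈ Tc, A τ) (hsh : ∑ τ ∈ Tc, sh τ ≤ wsh * ∑ τ ∈ Tc, A τ) :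
    ∑ τ ∈ Tc, (if τ ∈ Bd then A τ else sh τ) ≤ (w + wsh) * ∑ τ ∈ Tc, A τ := by
  have h1 : ∀ τ ∈ Tc, (if τ ∈ Bd then A τ else sh τ) ≤ (if τ ∈ Bd then A τ else 0) + sh τ := fun τ hτ => by
    split_ifs <;> [linarith [hsh0 τ hτ]; simp]
  calc ∑ τ ∈ Tc, (if τ ∈ Bd then A τ else sh τ)
      ≤ ∑ τ ∈ Tc, ((if τ ∈ Bd then A τ else 0) + sh τ) := Finset.sum_le_sum h1
    _ = ∑ τ ∈ Bd, A τ + ∑ τ ∈ Tc, sh τ := by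
        rw [Finset.sum_add_distrib, ← Finset.sum_filter, Finset.filter_mem_eq_inter, Finset.inter_eq_right.mpr hBd]
    _ ≤ w * ∑ τ ∈ Tc, A τ + wsh * ∑ τ ∈ Tc, A τ := add_le_add hbad hsh
    _ = (w + wsh) * ∑ τ ∈ Tc, A τ := by ring

/-- **THE FOLD, SHELL FACE** [folklore]: NE7b with `W` and NE7c with `Wsh` at one key give NE7c with `W + Wsh` for the FOLDED shells `sh♯ :=` the whole term on `Bad K t`, the
old shell off it (`sum_ite_bad_le`; termwise `0 ≤ sh♯ ≤ term` from the old shell face).  No `lt_one`, no core clause needed. -/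
theorem shellWeightBound_foldBad {T : ℕ → Finset ι} {A B shA shB : ℕ → ℝ → ι → ℝ} {Bad : ℕ → ℝ → Finset ι} {W Wsh : ℕ → ℝ}
    (hW : RelWeightBound l₀ T A B Bad W) (hSh : ShellWeightBound l₀ T A B shA shB Wsh) :
    ShellWeightBound l₀ T A B (fun K t τ => if τ ∈ Bad K t then A K t τ else shA K t τ)
      (fun K t τ => if τ ∈ Bad K t then B K t τ else shB K t τ) (fun K => W K + Wsh K) where
  nonneg K := add_nonneg (hW.nonneg K) (hSh.nonneg K)
  summable := hW.summable.add hSh.summable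
  sh_nonneg_left K t ht τ hτ := by
    split_ifs
    exacts [(hSh.sh_nonneg_left K t ht τ hτ).trans (hSh.sh_le_left K t ht τ hτ), hSh.sh_nonneg_left K t ht τ hτ]
  sh_le_left K t ht τ hτ := by
    split_ifs
    exacts [le_rfl, hSh.sh_le_left K t ht τ hτ]
  sh_nonneg_right K t ht τ hτ := by
    split_ifs
    exacts [(hSh.sh_nonneg_right K t ht τ hτ).trans (hSh.sh_le_right K t ht τ hτ), hSh.sh_nonneg_right K t ht τ hτ]
  sh_le_right K t ht τ hτ := by
    split_ifs
    exacts [le_rfl, hSh.sh_le_right K t ht τ hτ]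
  left K t ht := sum_ite_bad_le (hW.bad_subset K t ht) (hSh.sh_nonneg_left K t ht) (hW.bad_left K t ht) (hSh.left K t ht)
  right K t ht := sum_ite_bad_le (hW.bad_subset K t ht) (hSh.sh_nonneg_right K t ht) (hW.bad_right K t ht) (hSh.right K t ht)

/-- **THE FOLD, CORE FACE** [folklore]: the core clause on the good classes of `Bad` IS the core clause on ALL classes for the folded cores — on a formerly bad class both folded
cores vanish and the sandwich reads `e^{…}·0 ≤ 0 ≤ e^{…}·0`.  Same constant, same `δ`. -/
theorem core_foldBad {T : ℕ → Finset ι} {A B shA shB : ℕ → ℝ → ι → ℝ} {Bad : ℕ → ℝ → Finset ι} {δ : ℕ → ℝ}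
    (h : Core l₀ vol T Bad (fun K t τ => A K t τ - shA K t τ) (fun K t τ => B K t τ - shB K t τ) δ) :
    Core l₀ vol T (fun _ _ => ∅) (fun K t τ => A K t τ - if τ ∈ Bad K t then A K t τ else shA K t τ)
      (fun K t τ => B K t τ - if τ ∈ Bad K t then B K t τ else shB K t τ) δ := by
  intro K
  obtain ⟨c, hc⟩ := h K
  refine ⟨c, fun t ht τ hτ => ?_⟩
  rw [Finset.sdiff_empty] at hτ
  by_cases hb : τ ∈ Bad K t
  · simp only [hb, if_true, sub_self, mul_zero, le_refl, and_self]
  · simp only [hb, if_false]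
    exact hc t ht τ (Finset.mem_sdiff.mpr ⟨hτ, hb⟩)

/-- **★★ THE BAD ⇒ SHELL FOLD (same key)** [folklore]: in node U5's hybrid binder list the bad-CLASS slot is eliminable — declare EVERY class good and move the whole term of each
formerly bad class into its shell: `HybridNE7 l₀ vol T A B Bad W shA shB Wsh δ → HybridNE7 l₀ vol T A B ∅ 0 shA♯ shB♯ (W + Wsh) δ` (weight face := the empty one, shell face
`shellWeightBound_foldBad`, `lt_one` = `0 + (W + Wsh) < 1`, core face `core_foldBad`).  Converse direction («shell ⇒ bad class», at the price of refining the key to `ι ⊕ ι`):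
the tree's `T4IndicatorShell.relWeightBound_ref`. -/
theorem hybridNE7_foldBad {T : ℕ → Finset ι} {A B shA shB : ℕ → ℝ → ι → ℝ} {Bad : ℕ → ℝ → Finset ι} {W Wsh δ : ℕ → ℝ}
    (h : HybridNE7 l₀ vol T A B Bad W shA shB Wsh δ) :
    HybridNE7 l₀ vol T A B (fun _ _ => ∅) (fun _ => 0)
      (fun K t τ => if τ ∈ Bad K t then A K t τ else shA K t τ)
      (fun K t τ => if τ ∈ Bad K t then B K t τ else shB K t τ) (fun K => W K + Wsh K) δ where
  weight :=
    { bad_subset := fun _ _ _ => Finset.empty_subset _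
      nonneg := fun _ => le_rfl
      lt_one := fun _ => zero_lt_one
      summable := summable_zero
      bad_left := fun _ _ _ => by simp
      bad_right := fun _ _ _ => by simp }
  shell := shellWeightBound_foldBad h.weight h.shell
  lt_one K := by simpa only [zero_add] using h.lt_one K
  summable := h.summable
  core := core_foldBad h.core

/-- **THE FOLD IS OUTPUT-LOSSLESS** [folklore]: node U5's exit (`HybridNE7.matchingModConstants`) reads the weights only through `hybridDelta vol δ (W + Wsh)`, and
`0 + (W + Wsh) = W + Wsh`. -/
theorem hybridDelta_foldBad (vol : ℝ) (δ W Wsh : ℕ → ℝ) :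
    hybridDelta vol δ (fun K => (fun _ => (0 : ℝ)) K + (W K + Wsh K)) = hybridDelta vol δ fun K => W K + Wsh K := by
  simp only [zero_add]

end Fold

section Hybrid
variable [DecidableEq σ] {l₀ vol : ℝ} {S : ℕ → Finset σ} {T : ℕ → Finset ι} {π : ℕ → σ → ι} {a b sha shb : ℕ → ℝ → σ → ℝ}
  {SBad : ℕ → ℝ → Finset σ} {Bad : ℕ → ℝ → Finset ι} {W Wsh δ : ℕ → ℝ}

/-- **★★ SATURATED DESCENT OF THE WHOLE HYBRID BINDER LIST** [folklore]: `HybridNE7` at the fine key, a class map into `T`, a coarse bad class `Bad ⊆ T` SATURATED with respect to the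
fine one ⇒ `HybridNE7` at the coarse key for the fibre sums, with the SAME `W`, `Wsh`, `δ` (weight §3, shell §4, `lt_one`∕`summable` verbatim, core §2 on the re-keyed cores
`classVal a − classVal sha = classVal (a − sha)`). -/
theorem hybridNE7_classVal (h : HybridNE7 l₀ vol S a b SBad W sha shb Wsh δ)
    (hmaps : ∀ K, ∀ s ∈ S K, π K s ∈ T K) (hBad : ∀ (K : ℕ) (t : ℝ), |t| ≤ l₀ → Bad K t ⊆ T K)
    (hsat : ∀ (K : ℕ) (t : ℝ), |t| ≤ l₀ → ∀ s ∈ S K, (s ∈ SBad K t ↔ π K s ∈ Bad K t)) :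
    HybridNE7 l₀ vol T (classVal S π a) (classVal S π b) Bad W (classVal S π sha) (classVal S π shb) Wsh δ where
  weight := relWeightBound_classVal h.weight hmaps hBad (fun K t ht s hs => (hsat K t ht s hs).2)
    (fun K t ht s hs => (h.shell.sh_nonneg_left K t ht s hs).trans (h.shell.sh_le_left K t ht s hs))
    (fun K t ht s hs => (h.shell.sh_nonneg_right K t ht s hs).trans (h.shell.sh_le_right K t ht s hs))
  shell := shellWeightBound_classVal h.shell hmaps
  lt_one := h.lt_one
  summable := h.summable
  core := by
    have hc : Core l₀ vol T Bad (classVal S π fun K t s => a K t s - sha K t s) (classVal S π fun K t s => b K t s - shb K t s) δ :=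
      core_classVal (p := fun K t s => a K t s - sha K t s) (q := fun K t s => b K t s - shb K t s) h.core
        fun K t ht s hs hb => (hsat K t ht s hs).1 hb
    rw [classVal_sub_fun S π a sha, classVal_sub_fun S π b shb] at hc
    exact hc


/-- **★ UNSATURATED DESCENT = FOLD, THEN DESCEND** [folklore]: along ANY class map into `T` (fibres may mix bad with good) the hybrid binder list descends with every coarse class good,
`W ↦ 0`, `Wsh ↦ W + Wsh`, the fine bad terms re-keyed into the coarse shells, the same `δ` — no side condition (the empty bad classes are trivially saturated). -/
theorem hybridNE7_classVal_foldBad (h : HybridNE7 l₀ vol S a b SBad W sha shb Wsh δ) (hmaps : ∀ K, ∀ s ∈ S K, π K s ∈ T K) :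
    HybridNE7 l₀ vol T (classVal S π a) (classVal S π b) (fun _ _ => ∅) (fun _ => 0)
      (classVal S π fun K t s => if s ∈ SBad K t then a K t s else sha K t s)
      (classVal S π fun K t s => if s ∈ SBad K t then b K t s else shb K t s) (fun K => W K + Wsh K) δ :=
  hybridNE7_classVal (hybridNE7_foldBad h) hmaps (fun _ _ _ => Finset.empty_subset _) fun _ _ _ _ _ => by simp

/-- **`HybridNE7` AT THE IMAGE KEY** [folklore]: class set and bad class := the images; the one condition is that `π K` SEPARATES the fine bad class from its complement in `S K`
(no good term shares a key with a bad one) — then the image bad class is saturated. -/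
theorem hybridNE7_image (h : HybridNE7 l₀ vol S a b SBad W sha shb Wsh δ)
    (hsep : ∀ (K : ℕ) (t : ℝ), |t| ≤ l₀ → ∀ s ∈ S K, ∀ s' ∈ SBad K t, π K s = π K s' → s ∈ SBad K t) :
    HybridNE7 l₀ vol (fun K => (S K).image (π K)) (classVal S π a) (classVal S π b) (fun K t => (SBad K t).image (π K)) W
      (classVal S π sha) (classVal S π shb) Wsh δ :=
  hybridNE7_classVal h (fun K _ hs => Finset.mem_image_of_mem (π K) hs)
    (fun K t ht => Finset.image_subset_image (h.weight.bad_subset K t ht))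
    fun K t ht s hs => ⟨fun hb => Finset.mem_image_of_mem (π K) hb, fun hb => by
      obtain ⟨s', hs', he⟩ := Finset.mem_image.mp hb
      exact hsep K t ht s hs s' hs' he.symm⟩

/-- `HybridNE7` at the image key with NOTHING assumed: fold, then descend (`W ↦ 0`, `Wsh ↦ W + Wsh`). [folklore] -/
theorem hybridNE7_image_foldBad (h : HybridNE7 l₀ vol S a b SBad W sha shb Wsh δ) :
    HybridNE7 l₀ vol (fun K => (S K).image (π K)) (classVal S π a) (classVal S π b) (fun _ _ => ∅) (fun _ => 0)
      (classVal S π fun K t s => if s ∈ SBad K t then a K t s else sha K t s)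
      (classVal S π fun K t s => if s ∈ SBad K t then b K t s else shb K t s) (fun K => W K + Wsh K) δ :=
  hybridNE7_classVal_foldBad h fun K _ hs => Finset.mem_image_of_mem (π K) hs

end Hybrid

/-! ## §6 Sanity (kernel): the collapse dictionary on a two-key toy -/

/-- SANITY: two fine classes `Bool`, constant family `1`; the collapse re-keys it to the total `1 + 1 = 2`. [folklore] -/
example (K : ℕ) (t : ℝ) : classVal (fun _ => (Finset.univ : Finset Bool)) (fun _ _ => ()) (fun _ _ _ => (1 : ℝ)) K t () = 2 := by
  rw [classVal_collapse]
  norm_num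

end Summit.QuantumFields.YangMills.BalabanUVNodes.N19RekeyingCalculus

end
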